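import Mathlib.CategoryTheory.NatIso
import Mathlib.CategoryTheory.Equivalence
import Literature.AlgebraicGeometry.Frobenioids.Frobenioid
import Literature.AlgebraicGeometry.Frobenioids.Composites
import Literature.AlgebraicGeometry.Frobenioids.ElementaryFrobeniusFunctor
import HarnessLib

/-!
# Frobenioids I, §2: the naive Frobenius functor (Proposition 2.1, Remark 2.1.1)

Mochizuki, *The geometry of Frobenioids I*, Kyushu J. Math. **62** (2008), §2 "Frobenius Functors",
kurims pp. 44–45 [cite: MochizukiFrdI2008, Prop. 2.1 p.44].  Standing data of §2: a divisorial
monoid `Φ` on a connected, totally epimorphic category `D` and a Frobenioid `C → F_Φ`, here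
`F : C ⥤ ElemFrobenioid Φ` with the hypothesis `hF : IsFrobenioid F` where needed.

**Proposition 2.1 (i).** For `d ∈ ℕ_{≥1}` the assignment `A ↦ A'`, `φ ↦ φ'` — where `α : A → A'`,
`β : B → B'` are morphisms of Frobenius type of Frobenius degree `d` and `φ'` is the unique morphism
with `φ' ∘ α = β ∘ φ` [Prop. 1.10 (i)] — determines a functor `Ψ : C → C`, well-defined up to
isomorphism of functors, the *naive Frobenius functor of degree `d`*; the composite of the naive
Frobenius functors of degrees `d₁`, `d₂` is isomorphic to the one of degree `d₁ · d₂`.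
**(ii)** `Ψ` is `1`-compatible, relative to `C → F_Φ`, with the *Frobenius functor on `F_Φ`*
(induced by multiplication by `d` on `Φ`); and if `A = A'` is Frobenius-normalized with `α` a
base-identity endomorphism, the map `O^▷(A) → O^▷(A')` induced by `Ψ` is the `d`-th power map.
**(iii)** `C` is of perfect type iff `Ψ` is an equivalence.  **Remark 2.1.1**: for `C` of perfect
type and `d = a/b ∈ ℚ_{>0}` a "naive Frobenius functor of degree `d`", independent of `a, b`.

**Rendering.** The Frobenius functor on `F_Φ` is `ElemFrobenioid.frobenius`
(`ElementaryFrobeniusFunctor.lean`).  The choices `A ↦ (A', α)` are packaged as a `FrobeniusChoice F d` (they exist by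
Def. 1.3 (ii)); the functor `naiveFrobenius ch h` is *defined* from a choice `ch` and the
unique-lifting property `h : HasFrobeniusLifts F d`, which is precisely the conclusion of
Prop. 1.10 (i) (typed by seat L1-t1; TODO-merge: discharge `h` by L1-t1's theorem once landed).
PROVED here: functoriality (the "determines a functor" of (i)), well-definedness up to
isomorphism, the composite statement, (ii) both parts, the easy half of (iii)-type bookkeeping is
left with (iii) itself, which is recorded as a `Prop`-valued statement (`NaiveFrobeniusPerfectIff`),
as is the independence claim of Remark 2.1.1.  Composition is diagrammatic (`α ≫ φ' = φ ≫ β` is the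
printed `φ' ∘ α = β ∘ φ`).
-/

noncomputable section

namespace Literature.AlgebraicGeometry.Frobenioids

open CategoryTheory Opposite

universe w v v' u u'


namespace PreFrobenioid

variable {D : Type u} [Category.{v} D] {Φ : Dᵒᵖ ⥤ CommMonCat.{w}}
  {C : Type u'} [Category.{v'} C] (F : C ⥤ ElemFrobenioid Φ)

/-! ### Proposition 1.10 (i) as a named hypothesis (owner: seat L1-t1) -/

/-- The conclusion of Prop. 1.10 (i) in degree `d`: for `φ : A → B` and morphisms of Frobenius type
`α : A → A'`, `β : B → B'` of Frobenius degree `d` there is a unique `φ' : A' → B'` with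
`φ' ∘ α = β ∘ φ`, and `deg_Fr(φ') = deg_Fr(φ)`, `Div(φ') = d · α_*(Div(φ))` (equivalently
`α^*(Div(φ')) = d · Div(φ)`).  Used as a HYPOTHESIS in §2 (TODO-merge: it is proved for Frobenioids
in L1-t1's file on Prop. 1.10). [cite: MochizukiFrdI2008, Prop. 1.10(i) p.34] -/
def HasFrobeniusLifts (d : ℕ+) : Prop :=
  ∀ ⦃A B A' B' : C⦄ (φ : A ⟶ B) (α : A ⟶ A') (β : B ⟶ B'),
    IsFrobeniusType F α → degFr F α = d → IsFrobeniusType F β → degFr F β = d →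
      (∃! φ' : A' ⟶ B', α ≫ φ' = φ ≫ β) ∧
        ∀ φ' : A' ⟶ B', α ≫ φ' = φ ≫ β →
          degFr F φ' = degFr F φ ∧ pull Φ (Base F α) (Div F φ') = Div F φ ^ (d : ℕ)

/-! ### Proposition 2.1 (i): the naive Frobenius functor -/

/-- A choice, for every object `A`, of a morphism of Frobenius type `α_A : A → A'` of Frobenius
degree `d` (the data "`α : A → A'`, `β : B → B'` are morphisms of Frobenius type of Frobenius
degree `d`" of Prop. 2.1 (i); such choices exist by Def. 1.3 (ii)). [cite: MochizukiFrdI2008, Prop. 2.1(i) p.44] -/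
structure FrobeniusChoice (d : ℕ+) : Type (max u' v') where
  /-- `A ↦ A'` -/
  obj : C → C
  /-- the morphism of Frobenius type `α_A : A → A'` -/
  hom : ∀ A : C, A ⟶ obj A
  /-- `α_A` is of Frobenius type … -/
  isFrobeniusType : ∀ A : C, IsFrobeniusType F (hom A)
  /-- … of Frobenius degree `d` -/
  degFr_eq : ∀ A : C, degFr F (hom A) = d

/-- Frobenius choices of every degree exist in a Frobenioid (Def. 1.3 (ii), existence).
[cite: MochizukiFrdI2008, Prop. 2.1(i) p.44] -/
theorem nonempty_frobeniusChoice (hF : IsFrobenioid F) (d : ℕ+) : Nonempty (FrobeniusChoice F d) :=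
  ⟨{ obj := fun A => (hF.ii_exists A d).choose
     hom := fun A => (hF.ii_exists A d).choose_spec.choose
     isFrobeniusType := fun A => (hF.ii_exists A d).choose_spec.choose_spec.1
     degFr_eq := fun A => (hF.ii_exists A d).choose_spec.choose_spec.2 }⟩

variable {F}

namespace FrobeniusChoice

variable {d : ℕ+} (ch : FrobeniusChoice F d) (h : HasFrobeniusLifts F d)

/-- `φ ↦ φ'`: the unique morphism with `φ' ∘ α_A = α_B ∘ φ` (Prop. 2.1 (i), via Prop. 1.10 (i)).
[cite: MochizukiFrdI2008, Prop. 2.1(i) p.44] -/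
def lift {A B : C} (φ : A ⟶ B) : ch.obj A ⟶ ch.obj B :=
  (h φ (ch.hom A) (ch.hom B) (ch.isFrobeniusType A) (ch.degFr_eq A) (ch.isFrobeniusType B)
    (ch.degFr_eq B)).1.exists.choose

/-- The defining square `φ' ∘ α_A = α_B ∘ φ`. [cite: MochizukiFrdI2008, Prop. 2.1(i) p.44] -/
theorem hom_lift {A B : C} (φ : A ⟶ B) : ch.hom A ≫ ch.lift h φ = φ ≫ ch.hom B :=
  (h φ (ch.hom A) (ch.hom B) (ch.isFrobeniusType A) (ch.degFr_eq A) (ch.isFrobeniusType B)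
    (ch.degFr_eq B)).1.exists.choose_spec

/-- Uniqueness of `φ'` [Prop. 1.10 (i)]. [cite: MochizukiFrdI2008, Prop. 2.1(i) p.44] -/
theorem lift_unique {A B : C} (φ : A ⟶ B) (φ' : ch.obj A ⟶ ch.obj B)
    (hφ' : ch.hom A ≫ φ' = φ ≫ ch.hom B) : φ' = ch.lift h φ :=
  (h φ (ch.hom A) (ch.hom B) (ch.isFrobeniusType A) (ch.degFr_eq A) (ch.isFrobeniusType B)
    (ch.degFr_eq B)).1.unique hφ' (ch.hom_lift h φ)

/-- `deg_Fr(φ') = deg_Fr(φ)` [Prop. 1.10 (i)]. [cite: MochizukiFrdI2008, Prop. 2.1(i) p.44] -/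
theorem degFr_lift {A B : C} (φ : A ⟶ B) : degFr F (ch.lift h φ) = degFr F φ :=
  ((h φ (ch.hom A) (ch.hom B) (ch.isFrobeniusType A) (ch.degFr_eq A) (ch.isFrobeniusType B)
    (ch.degFr_eq B)).2 _ (ch.hom_lift h φ)).1

/-- `α_A^*(Div(φ')) = d · Div(φ)` [Prop. 1.10 (i)]. [cite: MochizukiFrdI2008, Prop. 2.1(i) p.44] -/
theorem pull_div_lift {A B : C} (φ : A ⟶ B) :
    pull Φ (Base F (ch.hom A)) (Div F (ch.lift h φ)) = Div F φ ^ (d : ℕ) :=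
  ((h φ (ch.hom A) (ch.hom B) (ch.isFrobeniusType A) (ch.degFr_eq A) (ch.isFrobeniusType B)
    (ch.degFr_eq B)).2 _ (ch.hom_lift h φ)).2

end FrobeniusChoice

section NaiveFrobenius

variable {d : ℕ+} (ch : FrobeniusChoice F d) (h : HasFrobeniusLifts F d)

/-- **Prop. 2.1 (i): the naive Frobenius functor** `Ψ : C → C` of degree `d` determined by the
assignment `A ↦ A'`, `φ ↦ φ'` — it IS a functor (identities and composites lift to identities and
composites, by uniqueness). [cite: MochizukiFrdI2008, Prop. 2.1(i) p.44] -/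
def naiveFrobenius : C ⥤ C where
  obj := ch.obj
  map φ := ch.lift h φ
  map_id A := (ch.lift_unique h (𝟙 A) (𝟙 _) (by rw [Category.comp_id, Category.id_comp])).symm
  map_comp φ ψ := (ch.lift_unique h (φ ≫ ψ) _ (by
    rw [← Category.assoc, ch.hom_lift h φ, Category.assoc, ch.hom_lift h ψ, Category.assoc])).symm

/-- `Ψ(A) = A'`. [cite: MochizukiFrdI2008, Prop. 2.1(i) p.44] -/
@[simp] theorem naiveFrobenius_obj (A : C) : (naiveFrobenius ch h).obj A = ch.obj A := rfl

/-- `Ψ(φ) = φ'`. [cite: MochizukiFrdI2008, Prop. 2.1(i) p.44] -/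
@[simp] theorem naiveFrobenius_map {A B : C} (φ : A ⟶ B) :
    (naiveFrobenius ch h).map φ = ch.lift h φ := rfl

/-- The structure morphisms `α_A : A → Ψ(A)` form a natural transformation `𝟭 → Ψ`.
[cite: MochizukiFrdI2008, Prop. 2.1(i) p.44] -/
def naiveFrobeniusUnit : 𝟭 C ⟶ naiveFrobenius ch h where
  app A := ch.hom A
  naturality _ _ φ := (ch.hom_lift h φ).symm

/-- **Prop. 2.1 (i), "well-defined up to isomorphism of functors"**: the naive Frobenius functors
of degree `d` built from two choices of the `α_A : A → A'` are isomorphic (components from the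
essential uniqueness of Def. 1.3 (ii), naturality from Prop. 1.10 (i)).
[cite: MochizukiFrdI2008, Prop. 2.1(i) p.44] -/
def naiveFrobeniusIso (hF : IsFrobenioid F) (ch ch' : FrobeniusChoice F d) (h : HasFrobeniusLifts F d) :
    naiveFrobenius ch h ≅ naiveFrobenius ch' h :=
  NatIso.ofComponents
    (fun A => (hF.ii_unique (ch.hom A) (ch'.hom A) (ch.isFrobeniusType A) (ch'.isFrobeniusType A)
      ((ch.degFr_eq A).trans (ch'.degFr_eq A).symm)).choose)
    (by
      intro A B φ
      have eA := (hF.ii_unique (ch.hom A) (ch'.hom A) (ch.isFrobeniusType A)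
        (ch'.isFrobeniusType A) ((ch.degFr_eq A).trans (ch'.degFr_eq A).symm)).choose_spec
      have eB := (hF.ii_unique (ch.hom B) (ch'.hom B) (ch.isFrobeniusType B)
        (ch'.isFrobeniusType B) ((ch.degFr_eq B).trans (ch'.degFr_eq B).symm)).choose_spec
      -- both composites `ξ` satisfy `α_A ≫ ξ = φ ≫ α'_B`; uniqueness of lifts (Prop. 1.10 (i))
      have huniq := (h φ (ch.hom A) (ch'.hom B) (ch.isFrobeniusType A) (ch.degFr_eq A)
        (ch'.isFrobeniusType B) (ch'.degFr_eq B)).1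
      refine huniq.unique ?_ ?_
      · change ch.hom A ≫ ch.lift h φ ≫ _ = _
        rw [← Category.assoc, ch.hom_lift h φ, Category.assoc, eB]
      · change ch.hom A ≫ _ ≫ ch'.lift h φ = _
        rw [← Category.assoc, eA, ch'.hom_lift h φ])

/-- The composite of two Frobenius choices: `A ↦ (A')'` with `α'_{A'} ∘ α_A`, of Frobenius type
(Prop. 1.7 (i)) and degree `d₁ · d₂` (Remark 1.1.1). [cite: MochizukiFrdI2008, Prop. 2.1(i) p.44] -/
def FrobeniusChoice.comp (hF : IsFrobenioid F) {d₁ d₂ : ℕ+} (ch₁ : FrobeniusChoice F d₁)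
    (ch₂ : FrobeniusChoice F d₂) : FrobeniusChoice F (d₁ * d₂) where
  obj A := ch₂.obj (ch₁.obj A)
  hom A := ch₁.hom A ≫ ch₂.hom (ch₁.obj A)
  isFrobeniusType A := IsFrobeniusType.comp F hF (ch₁.isFrobeniusType A) (ch₂.isFrobeniusType _)
  degFr_eq A := by rw [degFr_comp, ch₁.degFr_eq, ch₂.degFr_eq]

/-- Objects of the composite choice. [cite: MochizukiFrdI2008, Prop. 2.1(i) p.44] -/
@[simp] theorem FrobeniusChoice.comp_obj (hF : IsFrobenioid F) {d₁ d₂ : ℕ+} (ch₁ : FrobeniusChoice F d₁)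
    (ch₂ : FrobeniusChoice F d₂) (A : C) : (ch₁.comp hF ch₂).obj A = ch₂.obj (ch₁.obj A) := rfl

/-- Structure morphisms of the composite choice. [cite: MochizukiFrdI2008, Prop. 2.1(i) p.44] -/
@[simp] theorem FrobeniusChoice.comp_hom (hF : IsFrobenioid F) {d₁ d₂ : ℕ+} (ch₁ : FrobeniusChoice F d₁)
    (ch₂ : FrobeniusChoice F d₂) (A : C) :
    (ch₁.comp hF ch₂).hom A = ch₁.hom A ≫ ch₂.hom (ch₁.obj A) := rfl

/-- **Prop. 2.1 (i), composites**: `Ψ_{d₂} ∘ Ψ_{d₁}` is (isomorphic to — here even equal on objects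
and arrows) the naive Frobenius functor of degree `d₁ · d₂` for the composite choice; together with
`naiveFrobeniusIso` this gives the printed "is isomorphic to the naive Frobenius functor of degree
`d₁ · d₂`". [cite: MochizukiFrdI2008, Prop. 2.1(i) p.44] -/
def naiveFrobeniusCompIso (hF : IsFrobenioid F) {d₁ d₂ : ℕ+} (ch₁ : FrobeniusChoice F d₁)
    (ch₂ : FrobeniusChoice F d₂) (h₁ : HasFrobeniusLifts F d₁) (h₂ : HasFrobeniusLifts F d₂)
    (h₁₂ : HasFrobeniusLifts F (d₁ * d₂)) :
    naiveFrobenius ch₁ h₁ ⋙ naiveFrobenius ch₂ h₂ ≅ naiveFrobenius (ch₁.comp hF ch₂) h₁₂ :=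
  NatIso.ofComponents (fun _ => Iso.refl _) (by
    intro A B φ
    have key : ch₂.lift h₂ (ch₁.lift h₁ φ) = (ch₁.comp hF ch₂).lift h₁₂ φ := by
      apply (ch₁.comp hF ch₂).lift_unique h₁₂ φ
      change (ch₁.hom A ≫ ch₂.hom (ch₁.obj A)) ≫ ch₂.lift h₂ (ch₁.lift h₁ φ) =
        φ ≫ ch₁.hom B ≫ ch₂.hom (ch₁.obj B)
      rw [Category.assoc, ch₂.hom_lift h₂, ← Category.assoc, ch₁.hom_lift h₁, Category.assoc]
    simp only [Functor.comp_map, naiveFrobenius_map, Iso.refl_hom]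
    exact (Category.comp_id _).trans (key.trans (Category.id_comp _).symm))

/-- **Prop. 2.1 (i), composites (printed form)**: the composite of naive Frobenius functors of
degrees `d₁`, `d₂` is isomorphic to the naive Frobenius functor of degree `d₁ · d₂` (for any choice
of the latter). [cite: MochizukiFrdI2008, Prop. 2.1(i) p.44] -/
theorem naiveFrobenius_comp_iso (hF : IsFrobenioid F) {d₁ d₂ : ℕ+} (ch₁ : FrobeniusChoice F d₁)
    (ch₂ : FrobeniusChoice F d₂) (ch : FrobeniusChoice F (d₁ * d₂)) (h₁ : HasFrobeniusLifts F d₁)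
    (h₂ : HasFrobeniusLifts F d₂) (h₁₂ : HasFrobeniusLifts F (d₁ * d₂)) :
    Nonempty (naiveFrobenius ch₁ h₁ ⋙ naiveFrobenius ch₂ h₂ ≅ naiveFrobenius ch h₁₂) :=
  ⟨naiveFrobeniusCompIso hF ch₁ ch₂ h₁ h₂ h₁₂ ≪≫ naiveFrobeniusIso hF _ ch h₁₂⟩

/-! ### Proposition 2.1 (ii): `1`-compatibility with the Frobenius functor on `F_Φ` -/

/-- The isomorphism of functors `F ∘ (Frobenius on F_Φ) ≅ F ∘ Ψ`… precisely
`F ⋙ frobenius d ≅ naiveFrobenius ⋙ F`, with components `(Base(α_A), 0, 1)`; its naturality is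
exactly `deg_Fr(φ') = deg_Fr(φ)` and `α^*(Div φ') = d · Div(φ)` of Prop. 1.10 (i).
[cite: MochizukiFrdI2008, Prop. 2.1(ii) p.44] -/
def naiveFrobeniusCompatIso : F ⋙ ElemFrobenioid.frobenius Φ d ≅ naiveFrobenius ch h ⋙ F :=
  NatIso.ofComponents
    (fun A => ElemFrobenioid.isoMk Φ (@asIso _ _ _ _ (Base F (ch.hom A)) (ch.isFrobeniusType A).2))
    (by
      intro A B φ
      refine ElemFrobenioid.Hom.ext ?_ ?_ ?_
      · change Base F φ ≫ Base F (ch.hom B) = Base F (ch.hom A) ≫ Base F (ch.lift h φ)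
        rw [← base_comp, ← base_comp, ch.hom_lift h φ]
      · change pull Φ (Base F φ) 1 * (Div F φ ^ (d : ℕ)) ^ ((1 : ℕ+) : ℕ) =
          pull Φ (Base F (ch.hom A)) (Div F (ch.lift h φ)) * 1 ^ (degFr F (ch.lift h φ) : ℕ)
        rw [map_one, one_mul, PNat.one_coe, pow_one, one_pow, mul_one, ch.pull_div_lift h φ]
      · change degFr F φ * 1 = 1 * degFr F (ch.lift h φ)
        rw [mul_one, one_mul, ch.degFr_lift h φ])

/-- **Prop. 2.1 (ii)**: `Ψ` is `1`-compatible, relative to `C → F_Φ`, with the Frobenius functor of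
degree `d` on `F_Φ` (the square `1`-commutes in the sense of §0). [cite: MochizukiFrdI2008, Prop. 2.1(ii) p.44] -/
theorem naiveFrobenius_oneCommutes :
    OneCommutes F (ElemFrobenioid.frobenius Φ d) (naiveFrobenius ch h) F :=
  ⟨naiveFrobeniusCompatIso ch h⟩

/-- **Prop. 2.1 (ii), "Moreover"**: if `A' = A`, `A` is Frobenius-normalized and `α : A → A` is a
base-identity endomorphism (of Frobenius type, degree `d`), then `φ ↦ φ'` on `O^▷(A)` is raising to
the `d`-th power: the unique `β'` with `β' ∘ α = α ∘ β` is `β^d`. [cite: MochizukiFrdI2008, Prop. 2.1(ii) p.44] -/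
theorem lift_endSubmonoid_eq_pow (h : HasFrobeniusLifts F d) {A : C} (hA : IsFrobeniusNormalized F A)
    (α : A ⟶ A) (hα : IsFrobeniusType F α) (hαd : degFr F α = d) (hαb : IsBaseIdentity F α)
    (β : endSubmonoid F A) (β' : A ⟶ A) (hβ' : α ≫ β' = (show A ⟶ A from β.1) ≫ α) :
    β' = (show A ⟶ A from (β ^ (d : ℕ)).1) := by
  have hnorm : α ≫ (show A ⟶ A from (β ^ (d : ℕ)).1) = (show A ⟶ A from β.1) ≫ α := by
    have := hA α hαb β.1 β.2
    rw [hαd] at this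
    exact this
  exact (h (show A ⟶ A from β.1) α α hα hαd hα hαd).1.unique hβ' hnorm

/-! ### Proposition 2.1 (iii) and Remark 2.1.1 (statements) -/

variable (F) in
/-- **Prop. 2.1 (iii)** (statement): "`C` is of perfect type if and only if `Ψ` is an equivalence of
categories."  Rendered with `Ψ` ranging over the naive Frobenius functors of ALL degrees `d ∈ ℕ_{≥1}`
on the right-hand side: perfectness (Def. 1.2 (iv)) quantifies over every `n ∈ ℕ_{≥1}`, and for a
single degree (e.g. `d = 1`, where `Ψ ≅ id`) the converse implication is not what is proved on p. 44;
the forward implication holds degree by degree (`NaiveFrobeniusEquivalenceOfPerfect`).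
[cite: MochizukiFrdI2008, Prop. 2.1(iii) p.44] -/
def NaiveFrobeniusPerfectIff : Prop :=
  IsFrobenioid F →
    (IsOfPerfectType F ↔
      ∀ (d : ℕ+) (ch : FrobeniusChoice F d) (h : HasFrobeniusLifts F d), (naiveFrobenius ch h).IsEquivalence)

variable (F) in
/-- **Prop. 2.1 (iii)**, necessity, degree by degree (statement): if `C` is of perfect type then the
naive Frobenius functor of degree `d` is an equivalence ("essential surjectivity … from the definition
of perfect; fully faithful … by reduction to linear morphisms and pre-steps", pp. 44–45).
[cite: MochizukiFrdI2008, Prop. 2.1(iii) p.44] -/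
def NaiveFrobeniusEquivalenceOfPerfect (d : ℕ+) : Prop :=
  IsFrobenioid F → IsOfPerfectType F →
    ∀ (ch : FrobeniusChoice F d) (h : HasFrobeniusLifts F d), (naiveFrobenius ch h).IsEquivalence

/-- **Remark 2.1.1**: for `C` of perfect type (so that `Ψ_b` is an equivalence, Prop. 2.1 (iii)) and
`d = a/b ∈ ℚ_{>0}`, "composing the naive Frobenius functor of degree `a` with some quasi-inverse
functor to the naive Frobenius functor of degree `b`" — a *naive Frobenius functor of degree `d`*.
[cite: MochizukiFrdI2008, Rem. 2.1.1 p.45] -/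
def naiveFrobeniusRat {a b : ℕ+} (cha : FrobeniusChoice F a) (chb : FrobeniusChoice F b)
    (ha : HasFrobeniusLifts F a) (hb : HasFrobeniusLifts F b)
    [(naiveFrobenius chb hb).IsEquivalence] : C ⥤ C :=
  (naiveFrobenius chb hb).inv ⋙ naiveFrobenius cha ha

variable (F) in
/-- **Remark 2.1.1** (statement): the naive Frobenius functor of degree `d = a/b = a'/b'` "is
independent of the choice of `a`, `b`" — the two functors are isomorphic.
[cite: MochizukiFrdI2008, Rem. 2.1.1 p.45] -/
def NaiveFrobeniusRatIndependent : Prop :=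
  IsFrobenioid F → ∀ {a b a' b' : ℕ+} (cha : FrobeniusChoice F a) (chb : FrobeniusChoice F b)
    (cha' : FrobeniusChoice F a') (chb' : FrobeniusChoice F b')
    (ha : HasFrobeniusLifts F a) (hb : HasFrobeniusLifts F b)
    (ha' : HasFrobeniusLifts F a') (hb' : HasFrobeniusLifts F b')
    [(naiveFrobenius chb hb).IsEquivalence] [(naiveFrobenius chb' hb').IsEquivalence],
    a * b' = a' * b →
      Nonempty (naiveFrobeniusRat cha chb ha hb ≅ naiveFrobeniusRat cha' chb' ha' hb')

end NaiveFrobenius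

end PreFrobenioid

end Literature.AlgebraicGeometry.Frobenioids
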